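import Summits.MatrixMultiplication.OmegaCensus.STPPKernelListerCapstone2
import Summits.MatrixMultiplication.OmegaCensus.STPPKernelListerDeadZ59B
import Summits.MatrixMultiplication.OmegaCensus.STPPKernelListerRowsZ59S1
import Summits.MatrixMultiplication.OmegaCensus.STPPKernelListerRowsZ59S2
import Summits.MatrixMultiplication.OmegaCensus.STPPKernelListerRowsZ59S3
import Summits.MatrixMultiplication.OmegaCensus.STPPKernelListerRowsZ59S4
import Summits.MatrixMultiplication.OmegaCensus.STPPKernelListerRowsZ59S5
import Summits.MatrixMultiplication.OmegaCensus.STPPKernelListerRowsZ59S6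
import Summits.MatrixMultiplication.OmegaCensus.STPPKernelListerRowsZ59S7
import Summits.MatrixMultiplication.OmegaCensus.STPPKernelListerRowsZ59S8
import Summits.MatrixMultiplication.OmegaCensus.STPPKernelListerRowsZ59S9
import Summits.MatrixMultiplication.OmegaCensus.STPPKernelListerRowsZ59S10
import Summits.MatrixMultiplication.OmegaCensus.STPPKernelListerRowsZ59S11
import Summits.MatrixMultiplication.OmegaCensus.STPPKernelListerRowsZ59S12
import Summits.MatrixMultiplication.OmegaCensus.STPPKernelListerRowsZ59S13
import Summits.MatrixMultiplication.OmegaCensus.STPPKernelListerRowsZ59S14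
import Summits.MatrixMultiplication.OmegaCensus.STPPKernelListerRowsZ59S15
import Summits.MatrixMultiplication.OmegaCensus.STPPKernelListerRowsZ59S16
import Summits.MatrixMultiplication.OmegaCensus.STPPKernelListerRowsZ59S17
import Summits.MatrixMultiplication.OmegaCensus.STPPKernelListerRowsZ59S18
import Summits.MatrixMultiplication.OmegaCensus.STPPKernelListerRowsZ59S19
import Summits.MatrixMultiplication.OmegaCensus.STPPKernelListerRowsZ59S20
import Summits.MatrixMultiplication.OmegaCensus.STPPKernelListerRowsZ59S21
import Summits.MatrixMultiplication.OmegaCensus.STPPKernelListerRowsZ59S22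
import Summits.MatrixMultiplication.OmegaCensus.STPPKernelListerRowsZ59S23
import Summits.MatrixMultiplication.OmegaCensus.STPPKernelListerRowsZ59S24P1
import Summits.MatrixMultiplication.OmegaCensus.STPPKernelListerRowsZ59S24P2
import Summits.MatrixMultiplication.OmegaCensus.STPPKernelListerRowsZ59S24P3
import Summits.MatrixMultiplication.OmegaCensus.STPPKernelListerRowsZ59S24P4
import Summits.MatrixMultiplication.OmegaCensus.STPPKernelListerRowsZ59S24P5
import Summits.MatrixMultiplication.OmegaCensus.STPPKernelListerRowsZ59S24P6
import Summits.MatrixMultiplication.OmegaCensus.STPPKernelListerRowsZ59S24P7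
import Summits.MatrixMultiplication.OmegaCensus.STPPKernelListerRowsZ59S24P8
import Summits.MatrixMultiplication.OmegaCensus.STPPKernelListerRowsZ59S25
import Summits.MatrixMultiplication.OmegaCensus.STPPKernelListerRowsZ59S26
import Summits.MatrixMultiplication.OmegaCensus.STPPKernelListerRowsZ59S27
import Summits.MatrixMultiplication.OmegaCensus.STPPKernelListerRowsZ59S28
import Summits.MatrixMultiplication.OmegaCensus.STPPKernelListerRowsZ59S29
import Summits.MatrixMultiplication.OmegaCensus.STPPKernelListerRowsZ59S30
import Summits.MatrixMultiplication.OmegaCensus.STPPKernelListerRowsZ59S31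
import Summits.MatrixMultiplication.OmegaCensus.STPPKernelListerRowsZ59S32
import Summits.MatrixMultiplication.OmegaCensus.STPPKernelListerRowsZ59S33
import Summits.MatrixMultiplication.OmegaCensus.STPPKernelListerRowsZ59S34
import Summits.MatrixMultiplication.OmegaCensus.STPPKernelListerRowsZ59S35
import Summits.MatrixMultiplication.OmegaCensus.STPPKernelListerRowsZ59S36
import Summits.MatrixMultiplication.OmegaCensus.STPPKernelListerRowsZ59S37
import Summits.MatrixMultiplication.OmegaCensus.STPPKernelListerRowsZ59S38
import Summits.MatrixMultiplication.OmegaCensus.STPPKernelListerRowsZ59S39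
import Summits.MatrixMultiplication.OmegaCensus.STPPKernelListerRowsZ59S40
import Summits.MatrixMultiplication.OmegaCensus.STPPKernelListerRowsZ59S41
import Summits.MatrixMultiplication.OmegaCensus.STPPKernelListerRowsZ59S42
import Summits.MatrixMultiplication.OmegaCensus.STPPKernelListerRowsZ59S43

/-!
# ω-census (abelian STPP census): **ℤ_59 admits no beating STPP family — KERNEL** (capstone of the kernel lister)

HONEST FRAMING (pub-omega census; verbatim): lottery ticket; floor = certified bounds/negative ranges.
Census STRUCTURE (seat pub-omega-stpp-2 gen 29, 2026-08-29), family (b2).  Nothing here is progress on `ω`: the theorem says that the cyclic group of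
order 59 yields NO upper bound on `ω` below 3 through CKSU Thm. 5.5 with simultaneous-triple-product families, whatever the number of triples.
`volume_le_card_zmod59` — inputs: `volume_le_of_scan2`, the certified tables and dead list (`…DataZ59`), the 43 split row groups `…RowsZ59S1–S43` (50 files; group S24 in parts P1–P8), and the
non-realisability theorems (`…DeadZ59A/B`).
-/

open Finset

namespace Summit.MatrixMultiplication.OmegaCensus.KLister

open Literature.Computability.AlgebraicComplexity

/-- Every listed shape of order `59` is admissible. [folklore] -/
theorem adm_flat_chunksZ59 : ((flat chunksZ59).all (adm 59)) = true := by
  decide +kernel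

/-- Every admissible shape of order `59` is listed. [folklore] -/
theorem mem_flat_chunksZ59 (s : Shape) (hs : adm 59 s = true) : s ∈ flat chunksZ59 := by
  have e : flat chunksZ59 = shapeList 59 := chunksZ59_shapes
  rw [e]; exact mem_shapeList_of_adm hs

/-- The dead list of order `59` consists of non-realisable patterns. [folklore] -/
theorem deadZ59_notRealizable : ∀ D ∈ deadZ59, ¬ Realizable (ZMod 59) D := by
  intro D hD
  unfold deadZ59 at hD
  exact notRealizable_deadZ59 D hD

/-- The certificates (first-block selection, second-block selection) of the split root computation at `59`. [folklore] -/
def certsZ59 : List ((Shape → Bool) × (Shape → Bool)) :=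
  [((fun s => sel1Z59S1.contains s), (fun _ => true)),
   ((fun s => sel1Z59S2.contains s), (fun _ => true)),
   ((fun s => sel1Z59S3.contains s), (fun _ => true)),
   ((fun s => sel1Z59S4.contains s), (fun _ => true)),
   ((fun s => sel1Z59S5.contains s), (fun _ => true)),
   ((fun s => sel1Z59S6.contains s), (fun _ => true)),
   ((fun s => sel1Z59S7.contains s), (fun _ => true)),
   ((fun s => sel1Z59S8.contains s), (fun _ => true)),
   ((fun s => sel1Z59S9.contains s), (fun _ => true)),
   ((fun s => sel1Z59S10.contains s), (fun _ => true)),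
   ((fun s => sel1Z59S11.contains s), (fun _ => true)),
   ((fun s => sel1Z59S12.contains s), (fun _ => true)),
   ((fun s => sel1Z59S13.contains s), (fun _ => true)),
   ((fun s => sel1Z59S14.contains s), (fun _ => true)),
   ((fun s => sel1Z59S15.contains s), (fun _ => true)),
   ((fun s => sel1Z59S16.contains s), (fun _ => true)),
   ((fun s => sel1Z59S17.contains s), (fun _ => true)),
   ((fun s => sel1Z59S18.contains s), (fun _ => true)),
   ((fun s => sel1Z59S19.contains s), (fun _ => true)),
   ((fun s => sel1Z59S20.contains s), (fun _ => true)),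
   ((fun s => sel1Z59S21.contains s), (fun _ => true)),
   ((fun s => sel1Z59S22.contains s), (fun _ => true)),
   ((fun s => sel1Z59S23.contains s), (fun _ => true)),
   ((fun s => sel1Z59S24P1.contains s), (fun _ => true)),
   ((fun s => sel1Z59S24P2.contains s), (fun _ => true)),
   ((fun s => sel1Z59S24P3.contains s), (fun _ => true)),
   ((fun s => sel1Z59S24P4.contains s), (fun _ => true)),
   ((fun s => sel1Z59S24P5.contains s), (fun _ => true)),
   ((fun s => sel1Z59S24P6.contains s), (fun _ => true)),
   ((fun s => sel1Z59S24P7.contains s), (fun _ => true)),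
   ((fun s => sel1Z59S24P8.contains s), (fun _ => true)),
   ((fun s => sel1Z59S25.contains s), (fun t => (fun t => sel2Z59S25.contains t) t || (fun t => !(sel2Z59S25.contains t)) t)),
   ((fun s => sel1Z59S27.contains s), (fun t => (fun t => sel2Z59S27.contains t) t || (fun t => !(sel2Z59S27.contains t)) t)),
   ((fun s => sel1Z59S29.contains s), (fun t => (fun t => sel2Z59S29.contains t) t || (fun t => !(sel2Z59S29.contains t)) t)),
   ((fun s => sel1Z59S31.contains s), (fun t => (fun t => sel2Z59S31.contains t) t || (fun t => (fun t => sel2Z59S32.contains t) t || (fun t => !(sel2Z59S31.contains t || sel2Z59S32.contains t)) t) t)),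
   ((fun s => sel1Z59S34.contains s), (fun t => (fun t => sel2Z59S34.contains t) t || (fun t => !(sel2Z59S34.contains t)) t)),
   ((fun s => sel1Z59S36.contains s), (fun t => (fun t => sel2Z59S36.contains t) t || (fun t => !(sel2Z59S36.contains t)) t)),
   ((fun s => sel1Z59S38.contains s), (fun t => (fun t => sel2Z59S38.contains t) t || (fun t => !(sel2Z59S38.contains t)) t)),
   ((fun s => sel1Z59S40.contains s), (fun t => (fun t => sel2Z59S40.contains t) t || (fun t => !(sel2Z59S40.contains t)) t)),
   ((fun s => sel1Z59S42.contains s), (fun t => (fun t => sel2Z59S42.contains t) t || (fun t => !(sel2Z59S42.contains t)) t))]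

/-- Every listed shape is the first block of some certificate. [folklore] -/
theorem certsZ59_cover : ((flat chunksZ59).all fun s => certsZ59.any fun c => c.1 s) = true := by
  decide +kernel

/-- Every certificate: its second-block selection covers all shapes, and its split computation returns `true`. [folklore] -/
theorem certsZ59_scan : ∀ c ∈ certsZ59, (∀ x ∈ flat chunksZ59, c.2 x = true) ∧ scanFirstSel2C 59 deadZ59 c.1 c.2 chunksZ59 = true := by
  intro c hc
  simp only [certsZ59, List.mem_cons, List.not_mem_nil, or_false] at hc
  rcases hc with rfl | rfl | rfl | rfl | rfl | rfl | rfl | rfl | rfl | rfl | rfl | rfl | rfl | rfl | rfl | rfl | rfl | rfl | rfl | rfl | rfl | rfl | rfl | rfl | rfl | rfl | rfl | rfl | rfl | rfl | rfl | rfl | rfl | rfl | rfl | rfl | rfl | rfl | rfl | rfl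
  exacts [⟨fun _ _ => rfl, scanSel_Z59_S1⟩, ⟨fun _ _ => rfl, scanSel_Z59_S2⟩, ⟨fun _ _ => rfl, scanSel_Z59_S3⟩, ⟨fun _ _ => rfl, scanSel_Z59_S4⟩, ⟨fun _ _ => rfl, scanSel_Z59_S5⟩, ⟨fun _ _ => rfl, scanSel_Z59_S6⟩, ⟨fun _ _ => rfl, scanSel_Z59_S7⟩, ⟨fun _ _ => rfl, scanSel_Z59_S8⟩, ⟨fun _ _ => rfl, scanSel_Z59_S9⟩, ⟨fun _ _ => rfl, scanSel_Z59_S10⟩, ⟨fun _ _ => rfl, scanSel_Z59_S11⟩, ⟨fun _ _ => rfl, scanSel_Z59_S12⟩, ⟨fun _ _ => rfl, scanSel_Z59_S13⟩, ⟨fun _ _ => rfl, scanSel_Z59_S14⟩, ⟨fun _ _ => rfl, scanSel_Z59_S15⟩, ⟨fun _ _ => rfl, scanSel_Z59_S16⟩, ⟨fun _ _ => rfl, scanSel_Z59_S17⟩, ⟨fun _ _ => rfl, scanSel_Z59_S18⟩, ⟨fun _ _ => rfl, scanSel_Z59_S19⟩, ⟨fun _ _ => rfl, scanSel_Z59_S20⟩,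 ⟨fun _ _ => rfl, scanSel_Z59_S21⟩, ⟨fun _ _ => rfl, scanSel_Z59_S22⟩, ⟨fun _ _ => rfl, scanSel_Z59_S23⟩, ⟨fun _ _ => rfl, scanSel_Z59_S24P1⟩, ⟨fun _ _ => rfl, scanSel_Z59_S24P2⟩, ⟨fun _ _ => rfl, scanSel_Z59_S24P3⟩, ⟨fun _ _ => rfl, scanSel_Z59_S24P4⟩, ⟨fun _ _ => rfl, scanSel_Z59_S24P5⟩, ⟨fun _ _ => rfl, scanSel_Z59_S24P6⟩, ⟨fun _ _ => rfl, scanSel_Z59_S24P7⟩, ⟨fun _ _ => rfl, scanSel_Z59_S24P8⟩, ⟨fun x _ => by dsimp only; generalize sel2Z59S25.contains x = b0; cases b0 <;> rfl, (scanFirstSel2C_or2 chunksZ59 scanSel_Z59_S25 scanSel_Z59_S26)⟩, ⟨fun x _ => by dsimp only; generalize sel2Z59S27.contains x = b0; cases b0 <;> rfl, (scanFirstSel2C_or2 chunksZ59 scanSel_Z59_S27 scanSel_Z59_S28)⟩, ⟨fun x _ => by dsimp only; generalize sel2Z59S29.contains x = b0; cases b0 <;> rfl, (scanFirstSel2C_or2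 chunksZ59 scanSel_Z59_S29 scanSel_Z59_S30)⟩, ⟨fun x _ => by dsimp only; generalize sel2Z59S31.contains x = b0; generalize sel2Z59S32.contains x = b1; cases b0 <;> cases b1 <;> rfl, (scanFirstSel2C_or2 chunksZ59 scanSel_Z59_S31 (scanFirstSel2C_or2 chunksZ59 scanSel_Z59_S32 scanSel_Z59_S33))⟩, ⟨fun x _ => by dsimp only; generalize sel2Z59S34.contains x = b0; cases b0 <;> rfl, (scanFirstSel2C_or2 chunksZ59 scanSel_Z59_S34 scanSel_Z59_S35)⟩, ⟨fun x _ => by dsimp only; generalize sel2Z59S36.contains x = b0; cases b0 <;> rfl, (scanFirstSel2C_or2 chunksZ59 scanSel_Z59_S36 scanSel_Z59_S37)⟩, ⟨fun x _ => by dsimp only; generalize sel2Z59S38.contains x = b0; cases b0 <;> rfl, (scanFirstSel2C_or2 chunksZ59 scanSel_Z59_S38 scanSel_Z59_S39)⟩, ⟨fun x _ => by dsimp only; generalize sel2Z59S40.contains x = b0; cases b0 <;> rfl, (scanFirstSel2C_or2 chunksZ59 scanSel_Z59_S40 scanSel_Z59_S41)⟩, ⟨fun x _ => by dsimp only; generalize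 sel2Z59S42.contains x = b0; cases b0 <;> rfl, (scanFirstSel2C_or2 chunksZ59 scanSel_Z59_S42 scanSel_Z59_S43)⟩]

/-- **CAPSTONE (kernel): no simultaneous-triple-product family of `ℤ_59` beats the sum of cubes** — for every `m` and every STPP family
`(Aᵢ, Bᵢ, Cᵢ)_{i<m}` of `ℤ/59` (CKSU Def. 5.1), `Σᵢ |Aᵢ||Bᵢ||Cᵢ| ≤ 59`. [cite: CohnKleinbergSzegedyUmans2005, Def. 5.1, Thm. 5.5] -/
theorem volume_le_card_zmod59 {m : ℕ} (A B C : Fin m → Finset (ZMod 59)) (hS : IsSTPP A B C) : ∑ i, #(A i) * #(B i) * #(C i) ≤ 59 :=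
  volume_le_of_scan2 (H := ZMod 59) (n := 59) (ZMod.card 59) (by norm_num) chunksZ59 deadZ59 certsZ59 deadZ59_notRealizable chunksOK_Z59
    (fun s hs => List.all_eq_true.1 adm_flat_chunksZ59 s hs) mem_flat_chunksZ59
    (fun s hs => by
      have h := List.all_eq_true.1 certsZ59_cover s hs
      obtain ⟨c, hc, h1⟩ := List.any_eq_true.1 h
      exact ⟨c, hc, h1⟩)
    certsZ59_scan A B C hS

end Summit.MatrixMultiplication.OmegaCensus.KLister
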